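import Summits.QuantumFields.YangMills.Theorems.BalabanUVNodesK0AxChartRowsOfOrbit

/-!
# P3 g91 №17 — THE n24 JUNCTION THROUGH A COFINAL ⁸: THE HESSIAN ROW AND THE SIGN LETTER OWED ONLY IN THE SMALL-PARAMETER WINDOW — LENS P3 «weaken the target»

LANDING NOTE (porter ▶ PTC-1 g4, 2026-08-31; AUTHORSHIP = ★ P3 g91 «weaken the target», HOME sketch `nodeO-cover/P3-JunctionWindow-v1.lean` sha16 03ad8ea6a011663d · 118 l. · 1 def (displayed
candidate text `Sig8LR4BoxBelow F εw` = ✓`Sig8LR4Box F`'s own body with ONE conjunct `ε₂₉ ≤ εw` inserted; the COFINAL ⁸ is `∀ εw > 0, Sig8LR4BoxBelow F εw`) + 3 thm · 0 sorry (№17 v1 «the junction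
through a cofinal ⁸ — window letters» = ◆ CRIT-1 g38's §5 repair road of record, typed)): landed VERBATIM (only this paragraph added) under P3's basename
(`…Theorems/BalabanUVNodesK0AxJunctionWindow.lean`, ns `…Theorems.K0AxJunctionWindow`) as INTENT-67 (◆ g38's numbering), after ✓p822712 `…K0AxChartRowsOfOrbit` (№16, its one import); `--supports
stmt-QuantumFields-27238 --as helper` (NO `--workitem`; kind definition → async audit); ◆ CRIT-1 g38's cut: «(4) CUT — ★ P3 №17 v1 → `…K0AxJunctionWindow.lean`: GO VERBATIM; standalone farm rc 0 ·
0 warn · 0 sorry, axioms std guarded on all 3 thm, dedup 4 names + ns = 0; J5′ on the ONE def: body = ✓`Sig8LR4Box`'s body with EXACTLY ONE conjunct `ε₂₉ ≤ εw` inserted — verified mechanically — a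
NEW LETTER with a real content delta, PASS; DRIFT CAVEAT: a byte-copy of ⁸'s body, so any re-signing of ⁸ must re-sign Below (`sig8LR4Box_of_below` is the compile-time drift alarm); (Q-ord) LEGAL
(window chosen before ⁸ is asked); RATE-LEVER: §5 flag CLEARED on this door; SAME-WALL: SURVIVES (priced) — the price MOVED from the two letters to ⁸'s signature (cofinal ⁸)» (nodeO STATUS
2026-08-31T12:28:58Z).  HONEST (porter): a typed repair road — CONDITIONAL doors + one displayed def; cofinal ⁸ ∕ ⁸ signed NOWHERE, JOIN antecedents ∕ (C-orb)♭ ∕ window letters inhabited NOWHERE;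
nothing of Bałaban asserted, ported, discharged or refuted; K0ᴬ stmt-QuantumFields-27238 ∕ K1ᴬ 27239 OPEN — NOTHING of them proved; ⟨27930⟩ v3.4 `stub_FE` text untouched; NODE O 0∕1; COUNT 8∕28 ·
K 1∕4 UNMOVED; finite 𝕋⁴ at fixed ε — NOT continuum ∕ OS ∕ Clay; the Yang–Mills mass gap is NOT proved by any of this.

ym-nodeO-ideate ★ P3 g91 (count-neutral author seat; sketch OFFERED to ◆ CRIT-1 ∕ ▶ PTC-1 — P3 files nothing).  WHAT THIS FILE DOES, exactly.  №16 §5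
(✓`cofinalBetaSocketAxBody_allRadii_of_sig8LR4Box_antecedents_orb_hess_negPart`, `…K0AxChartRowsOfOrbit`) keys the n24 junction's binder `hβc` to K0ᴬ's displayed triple {⁸-on-the-box
`Sig8LR4Box`, `JoinAntecedentsCofinal`, (C-orb)♭} plus TWO letters — the Hessian-continuity row (V-hess-cont-box) and the sign letter (L-negpart-box) — asked at EVERY `a₀ ε₂₉ > 0`, `0 < γ₀ ≤ ½`,
because ⁸ binds its `γ₀ ε₂₉` existentially inside its conclusion.  ◆ CRIT-1 g38 priced that (STATUS l.5379): the sign letter at every `ε₂₉` is SUSPECT-STRONG (print gives signs only for small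
parameters); repair road of record = «a COFINAL ⁸ (`∀ ε̄ γ̄ > 0, ∃ ε₂₉ ≤ ε̄, γ₀ ≤ γ̄, …`), after which the letters are owed only in the window».  This file TYPES that road:
§1 `Sig8LR4BoxBelow F εw` = ✓`Sig8LR4Box F`'s own body with ONE conjunct `ε₂₉ ≤ εw` inserted (the `γ̄`-half of the road is FREE: D1 on a box is monotone in the box, so ⁸'s level is shrunk
   inside the proof); ★`sig8LR4Box_of_below` (each instance ⟹ ⁸); ★ K0ᴬ BY NAME from the cofinal ⁸ (№16 §2′ unchanged — the re-signing costs K0ᴬ nothing);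
§2 ★★`cofinalBetaSocketAxBody_allRadii_of_sig8LR4BoxCofinal_antecedents_orb_window`: cofinal ⁸ + the JOIN's cofinal antecedents + (C-orb)♭ + ONE window hypothesis `hWin` (per `(F, a₀)`:
   `∃ εw γw > 0`, and for `0 < ε₂₉ ≤ εw`, `0 < γ₀ ≤ γw`, `γ₀ ≤ ½` the Hessian row ∧ `∃ e`, the sign letter) ⟹ `∀ F a, 0 < a → CofinalBetaSocketAxBody F a` — the consumer takes the window
   FIRST, asks ⁸ below `εw` at the JOIN's cube letter, shrinks the level to `min γ₀ (min γw ½)`, and reads the two letters INSIDE the window only.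
EDGE CONTENT (LENS-P3 decision table, box road): junction residue = {cofinal ⁸ (`∀ εw > 0, Sig8LR4BoxBelow F εw`), `JoinAntecedentsCofinal`, (C-orb)♭} + {Hessian row, sign letter} IN THE
WINDOW; K0ᴬ's residue = {⁸ (or the cofinal ⁸), `JoinAntecedentsCofinal`, (C-orb)♭} unchanged.  The price moved from the two letters (∀ parameters ↦ window) to ⁸ (one ∃ ↦ cofinal in `ε₂₉`).
WHAT IT IS NOT.  `Sig8LR4BoxBelow` is a CANDIDATE port text beside ⁸ (⟨27930⟩'s FE half on the box), signed NOWHERE — whether the porter's FE half can be signed cofinally in the (2.9)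
parameter is THE question this file displays, not answers; `JoinAntecedentsCofinal`, (C-orb)♭, the window letters are OPEN and inhabited NOWHERE.  Nothing here discharges any of them.

HONEST FRAMING.  CONDITIONAL doors (kernel-checked implications between DISPLAYED rows; audit `proof.conditional` ∕ orphan helpers, credits nothing); ONE `def` (a displayed Prop, audit
class `vendored-fact` exactly like ✓`Sig8LR4Box`); NOTHING of Bałaban is asserted, ported, discharged or refuted; K0ᴬ stmt-QuantumFields-27238 OPEN — NOTHING of it proved; K1ᴬ 27239 ∕
K3ᴬ 27247 ∕ ⟨27930⟩ OPEN; NODE O `B13TermWalkDataOneTorus.ExistsUniformAcrossSmall` NOT inhabited (0∕1); COUNT 8∕28 · K 1∕4 UNMOVED; finite `𝕋⁴_{L^K}` at fixed ε — NOT continuum ∕ ℝ⁴ ∕ OS;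
R4 = the conditional `BalabanLadder.UV` rung only; **the Yang–Mills mass gap (Clay) is NOT proved by any of this.**  No `sorry`, no `instance`, no `notation`; standard axioms.

References: T. Bałaban, *Renormalization group approach to lattice gauge field theories. I*, Comm. Math. Phys. 109 (1987) 249–301 [Balaban1987RG1] — Thm 2 (0.31) p.259, Thm 3 p.264,
(0.29)–(0.31) p.259, (1.18)–(1.22) pp.263–264, (5.38)–(5.44) pp.296–297; T. Bałaban, *The variational problem and background fields in renormalization group method for lattice gauge
theories*, Comm. Math. Phys. 102 (1985) 277–309 [Balaban1985Variational] — Prop. 9 p.309, (176)–(178) p.306.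
-/

open Filter Topology
open scoped BigOperators Matrix.Norms.L2Operator

namespace Summit.QuantumFields.YangMills.Theorems.K0AxJunctionWindow

open Literature.MathematicalPhysics.QuantumFieldTheory.Balaban1983to89
open Literature.MathematicalPhysics.QuantumFieldTheory.Balaban1983to89.Node00 (betaOfRecord₁₃Ax Stage13Params SU)
open Literature.MathematicalPhysics.QuantumFieldTheory.Balaban1983to89.T4Continuum (T4Family)
open Literature.MathematicalPhysics.QuantumFieldTheory.Balaban1983to89.B12FormatPlus
open Literature.MathematicalPhysics.QuantumFieldTheory.Balaban1983to89.FlowStep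
open Literature.MathematicalPhysics.QuantumFieldTheory.Balaban1983to89.FlowStepRuns
open Summit.QuantumFields.YangMills.Theorems.K0RecordFormatNames
open Summit.QuantumFields.YangMills.Theorems.K0AxMomentRoad
open Summit.QuantumFields.YangMills.Theorems.PortHRecordJoin (JoinAntecedentsCofinal TokP9L4Old)
open Summit.QuantumFields.YangMills.Theorems.BalabanUVNodesPortS1 (Sig8LR4Box)
open Summit.QuantumFields.YangMills.Theorems.K0AxChartRowsOfOrbit (chartRowsBox_of_orbit record13SepCoPHInhabitedAx_of_sig8LR4Box_antecedents_orb)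

/-! ## §1  The cofinal ⁸: `Sig8LR4BoxBelow` + bridge to ⁸ + K0ᴬ unchanged -/

/-- **`Sig8LR4BoxBelow F εw` — ⁸ ON THE BOX WITH THE (2.9) PARAMETER BELOW `εw`**: ✓`Sig8LR4Box F` VERBATIM (the tree's own pretty-printed body, ✓`…PortS1BoxEditions` :73–:74) with ONE conjunct
`ε₂₉ ≤ εw` inserted after `0 < ε₂₉` in its conclusion.  The COFINAL ⁸ is `∀ εw > 0, Sig8LR4BoxBelow F εw` («FE-on-the-box with the small-field restriction parameter as small as asked; the
constants `E₀ κ α₀ α₁` and the cube floor `Mth` may depend on it»).  ✓`sig8LR4Box_of_below`: each instance implies ⁸, so K0ᴬ's door №16 §2′ ✓`record13SepCoPHInhabitedAx_of_sig8LR4Box_antecedents_orb` is fed by the cofinal ⁸ unchanged.  OPEN port text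
(Bałaban-strength, a CANDIDATE shape beside ⁸ — signed NOWHERE; nothing asserted). [cite: Balaban1987RG1, Thm 3 p.264, (1.18)–(1.22) pp.263–264, (0.29)–(0.31) p.259] -/
def Sig8LR4BoxBelow (F : Literature.MathematicalPhysics.QuantumFieldTheory.Balaban1983to89.T4Continuum.T4Family) (εw : ℝ) : Prop :=
  ∃ Mth : ℕ, ∀ Mc : ℕ, Mth ≤ Mc → ∀ (j c c₀ c₁ : ℕ) (B₃ B₃' a₀ a₁ : ℝ), Summit.QuantumFields.YangMills.Theorems.K0RecordFormatNames.McGuard F Mc → c ≤ F.L ^ j → c₀ ≤ j + 1 → c₁ ≤ j → 2 * (F.L : ℝ) ^ 2 ≤ B₃ → 0 < B₃' → 0 < a₀ → 0 < a₁ → Literature.MathematicalPhysics.QuantumFieldTheory.Balaban1983to89.Node00.VariationalThm1RegSepCoP7MGB F 2 (fun ν M g K k _s => c ≤ ν.M₁ ∧ k + c₀ ≤ F.m + K ∧ F.L ^ c₁ ∣ M ∧ ∀ i, 1 ≤ i → i ≤ k → Literature.MathematicalPhysics.QuantumFieldTheory.Balaban1983to89.Node00.dCubeSide (F.P K).L M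 (Literature.MathematicalPhysics.QuantumFieldTheory.Balaban1983to89.Node00.RkOfRecord (F.P K).L ν.r (g i)) i ∣ (F.P K).sitesPerDir 0) (Literature.MathematicalPhysics.QuantumFieldTheory.Balaban1983to89.Node00.lamDatum F) (Literature.MathematicalPhysics.QuantumFieldTheory.Balaban1983to89.Node00.dataSmall7LamTopOf F 2) B₃ a₀ a₁ → Literature.MathematicalPhysics.QuantumFieldTheory.Balaban1983to89.Node00.Gauge9RegSepTopStepGB F 2 (fun ν K Ω => Literature.MathematicalPhysics.QuantumFieldTheory.Balaban1983to89.Node00.suppDomOfRecord F ν K Ω) (F.L ^ j) (fun ν M g K k _s => c ≤ ν.M₁ ∧ k + c₀ ≤ F.m + K ∧ F.L ^ c₁ ∣ M ∧ ∀ i, 1 ≤ i → i ≤ k → Literature.MathematicalPhysics.QuantumFieldTheory.Balaban1983to89.Node00.dCubeSide (F.P K).L M (Literature.MathematicalPhysics.QuantumFieldTheory.Balaban1983to89.Node00.RkOfRecord (F.P K).L ν.r (g i)) i ∣ (F.P K).sitesPerDir 0) (Literature.MathematicalPhysics.QuantumFieldTheory.Balaban1983to89.Node00.lamDatum F) (Literature.MathematicalPhysics.QuantumFieldTheory.Balaban1983to89.Node00.dataSmall7LamTopOf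 F 2) B₃ B₃' a₀ a₁ → (∀ ε₁ : ℝ, 0 < ε₁ → ε₁ ≤ a₁ → B₃ * ε₁ ≤ a₀ → ∀ (k n : ℕ) (V : Literature.MathematicalPhysics.QuantumFieldTheory.Balaban1983to89.GaugeField (F.P (Summit.QuantumFields.YangMills.Theorems.K0RecordFormatNames.recordK₀ F Mc k + n)) (k + 1) (Literature.MathematicalPhysics.QuantumFieldTheory.Balaban1983to89.Node00.SU 2)), Literature.MathematicalPhysics.QuantumFieldTheory.Balaban1983to89.PlaqSmall ε₁ V → Literature.MathematicalPhysics.QuantumFieldTheory.Balaban1983to89.Node00.UkExists F 2 (Summit.QuantumFields.YangMills.Theorems.K0RecordFormatNames.recordK₀ F Mc k + n) (k + 1) a₀ V ∧ Literature.MathematicalPhysics.QuantumFieldTheory.Balaban1983to89.Node00.UniqueUkOrbit F 2 (Summit.QuantumFields.YangMills.Theorems.K0RecordFormatNames.recordK₀ F Mc k + n) (k + 1) a₀ V) → (∀ (k n : ℕ) (ε₂₉ : ℝ), 0 < ε₂₉ → letI θ := Summit.QuantumFields.YangMills.Theorems.K0RecordFormatNames.thetaFill F a₀ ε₂₉; letI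 := θ.instVβ₁; letI := θ.instVβ₂; letI := θ.instιβ; AnalyticAt ℝ (fun B : Summit.QuantumFields.YangMills.Theorems.K0RecordFormatNames.recordW F a₀ ε₂₉ k (Summit.QuantumFields.YangMills.Theorems.K0RecordFormatNames.recordK₀ F Mc k + n) => fun (b : Literature.MathematicalPhysics.QuantumFieldTheory.Balaban1983to89.PBond (F.P (Summit.QuantumFields.YangMills.Theorems.K0RecordFormatNames.recordK₀ F Mc k + n)) 0) (i i' : Fin 2) => ((Summit.QuantumFields.YangMills.Theorems.K0RecordFormatNames.recordBgField F θ k (Summit.QuantumFields.YangMills.Theorems.K0RecordFormatNames.recordK₀ F Mc k + n) B b : Literature.MathematicalPhysics.QuantumFieldTheory.Balaban1983to89.Node00.SU 2) : Matrix (Fin 2) (Fin 2) ℂ) i i') 0) → (∃ C₉' δ₉ : ℝ, 0 ≤ C₉' ∧ 0 < δ₉ ∧ ∀ (k n : ℕ) (ε₂₉ : ℝ), 0 < ε₂₉ → letI θ := Summit.QuantumFields.YangMills.Theorems.K0RecordFormatNames.thetaFill F a₀ ε₂₉; letI := θ.instVβ₁; letI := θ.instVβ₂; letI := θ.instιβ;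 ∀ (a : θ.ιβ) (μ : Fin (F.P (Summit.QuantumFields.YangMills.Theorems.K0RecordFormatNames.recordK₀ F Mc k + n)).d) (y : Literature.MathematicalPhysics.QuantumFieldTheory.Balaban1983to89.Site (F.P (Summit.QuantumFields.YangMills.Theorems.K0RecordFormatNames.recordK₀ F Mc k + n)) (k + 1)), letI D := fderiv ℝ (fun B : Summit.QuantumFields.YangMills.Theorems.K0RecordFormatNames.recordW F a₀ ε₂₉ k (Summit.QuantumFields.YangMills.Theorems.K0RecordFormatNames.recordK₀ F Mc k + n) => fun (b : Literature.MathematicalPhysics.QuantumFieldTheory.Balaban1983to89.PBond (F.P (Summit.QuantumFields.YangMills.Theorems.K0RecordFormatNames.recordK₀ F Mc k + n)) 0) (i i' : Fin 2) => ((Summit.QuantumFields.YangMills.Theorems.K0RecordFormatNames.recordBgField F θ k (Summit.QuantumFields.YangMills.Theorems.K0RecordFormatNames.recordK₀ F Mc k + n) B b : Literature.MathematicalPhysics.QuantumFieldTheory.Balaban1983to89.Node00.SU 2) : Matrix (Fin 2) (Fin 2) ℂ) i i') 0 (Pi.single μ (Pi.single y (θ.bV a))); ∃ (Hr : Literature.MathematicalPhysics.QuantumFieldTheory.Balaban1983to89.PBond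 (F.P (Summit.QuantumFields.YangMills.Theorems.K0RecordFormatNames.recordK₀ F Mc k + n)) 0 → Fin 2 → Fin 2 → ℂ) (φ : Literature.MathematicalPhysics.QuantumFieldTheory.Balaban1983to89.Site (F.P (Summit.QuantumFields.YangMills.Theorems.K0RecordFormatNames.recordK₀ F Mc k + n)) 0 → Fin 2 → Fin 2 → ℂ), (∀ b : Literature.MathematicalPhysics.QuantumFieldTheory.Balaban1983to89.PBond (F.P (Summit.QuantumFields.YangMills.Theorems.K0RecordFormatNames.recordK₀ F Mc k + n)) 0, D b = Hr b + (φ b.src - φ (b.src.shift b.dir))) ∧ (∃ μc : Literature.MathematicalPhysics.QuantumFieldTheory.Balaban1983to89.Site (F.P (Summit.QuantumFields.YangMills.Theorems.K0RecordFormatNames.recordK₀ F Mc k + n)) (k + 1) → Fin 2 → Fin 2 → ℂ, ∀ x : Literature.MathematicalPhysics.QuantumFieldTheory.Balaban1983to89.Site (F.P (Summit.QuantumFields.YangMills.Theorems.K0RecordFormatNames.recordK₀ F Mc k + n)) 0, letI dv := (fun x' : Literature.MathematicalPhysics.QuantumFieldTheory.Balaban1983to89.Site (F.P (Summit.QuantumFields.YangMills.Theorems.K0RecordFormatNames.recordK₀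 F Mc k + n)) 0 => ∑ ν : Fin (F.P (Summit.QuantumFields.YangMills.Theorems.K0RecordFormatNames.recordK₀ F Mc k + n)).d, (Hr ⟨x', ν⟩ - Hr ⟨x'.unshift ν, ν⟩)); ∑ ν : Fin (F.P (Summit.QuantumFields.YangMills.Theorems.K0RecordFormatNames.recordK₀ F Mc k + n)).d, (dv (x.shift ν) - (2 : ℂ) • dv x + dv (x.unshift ν)) = μc (Summit.QuantumFields.YangMills.Theorems.K0RecordFormatNames.coarsenTo (k + 1) x)) ∧ ∀ b : Literature.MathematicalPhysics.QuantumFieldTheory.Balaban1983to89.PBond (F.P (Summit.QuantumFields.YangMills.Theorems.K0RecordFormatNames.recordK₀ F Mc k + n)) 0, ‖Hr b‖ ≤ C₉' * (F.P (Summit.QuantumFields.YangMills.Theorems.K0RecordFormatNames.recordK₀ F Mc k + n)).eta (k + 1) * Real.exp (-(δ₉ * (Literature.MathematicalPhysics.QuantumFieldTheory.Balaban1983to89.Site.tdist (Summit.QuantumFields.YangMills.Theorems.K0RecordFormatNames.coarsenTo (k + 1) b.src) y : ℝ))) ∧ (∀ ν : Fin (F.P (Summit.QuantumFields.YangMills.Theorems.K0RecordFormatNames.recordK₀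 F Mc k + n)).d, ‖Hr (⟨b.src.shift ν, b.dir⟩ : Literature.MathematicalPhysics.QuantumFieldTheory.Balaban1983to89.PBond (F.P (Summit.QuantumFields.YangMills.Theorems.K0RecordFormatNames.recordK₀ F Mc k + n)) 0) - Hr b‖ ≤ C₉' * (F.P (Summit.QuantumFields.YangMills.Theorems.K0RecordFormatNames.recordK₀ F Mc k + n)).eta (k + 1) ^ 2 * Real.exp (-(δ₉ * (Literature.MathematicalPhysics.QuantumFieldTheory.Balaban1983to89.Site.tdist (Summit.QuantumFields.YangMills.Theorems.K0RecordFormatNames.coarsenTo (k + 1) b.src) y : ℝ)))) ∧ ‖∑ ν : Fin (F.P (Summit.QuantumFields.YangMills.Theorems.K0RecordFormatNames.recordK₀ F Mc k + n)).d, (Hr (⟨b.src.shift ν, b.dir⟩ : Literature.MathematicalPhysics.QuantumFieldTheory.Balaban1983to89.PBond (F.P (Summit.QuantumFields.YangMills.Theorems.K0RecordFormatNames.recordK₀ F Mc k + n)) 0) - (2 : ℂ) • Hr b + Hr (⟨b.src.unshift ν, b.dir⟩ : Literature.MathematicalPhysics.QuantumFieldTheory.Balaban1983to89.PBond (F.P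 (Summit.QuantumFields.YangMills.Theorems.K0RecordFormatNames.recordK₀ F Mc k + n)) 0))‖ ≤ C₉' * (F.P (Summit.QuantumFields.YangMills.Theorems.K0RecordFormatNames.recordK₀ F Mc k + n)).eta (k + 1) ^ 3 * Real.exp (-(δ₉ * (Literature.MathematicalPhysics.QuantumFieldTheory.Balaban1983to89.Site.tdist (Summit.QuantumFields.YangMills.Theorems.K0RecordFormatNames.coarsenTo (k + 1) b.src) y : ℝ))) ∧ ‖∑ ν : Fin (F.P (Summit.QuantumFields.YangMills.Theorems.K0RecordFormatNames.recordK₀ F Mc k + n)).d, ((Hr (⟨b.src, b.dir⟩ : Literature.MathematicalPhysics.QuantumFieldTheory.Balaban1983to89.PBond (F.P (Summit.QuantumFields.YangMills.Theorems.K0RecordFormatNames.recordK₀ F Mc k + n)) 0) + Hr (⟨(b.src).shift b.dir, ν⟩ : Literature.MathematicalPhysics.QuantumFieldTheory.Balaban1983to89.PBond (F.P (Summit.QuantumFields.YangMills.Theorems.K0RecordFormatNames.recordK₀ F Mc k + n)) 0) - Hr (⟨(b.src).shift ν, b.dir⟩ : Literature.MathematicalPhysics.QuantumFieldTheory.Balaban1983to89.PBond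 (F.P (Summit.QuantumFields.YangMills.Theorems.K0RecordFormatNames.recordK₀ F Mc k + n)) 0) - Hr (⟨b.src, ν⟩ : Literature.MathematicalPhysics.QuantumFieldTheory.Balaban1983to89.PBond (F.P (Summit.QuantumFields.YangMills.Theorems.K0RecordFormatNames.recordK₀ F Mc k + n)) 0)) - (Hr (⟨b.src.unshift ν, b.dir⟩ : Literature.MathematicalPhysics.QuantumFieldTheory.Balaban1983to89.PBond (F.P (Summit.QuantumFields.YangMills.Theorems.K0RecordFormatNames.recordK₀ F Mc k + n)) 0) + Hr (⟨(b.src.unshift ν).shift b.dir, ν⟩ : Literature.MathematicalPhysics.QuantumFieldTheory.Balaban1983to89.PBond (F.P (Summit.QuantumFields.YangMills.Theorems.K0RecordFormatNames.recordK₀ F Mc k + n)) 0) - Hr (⟨(b.src.unshift ν).shift ν, b.dir⟩ : Literature.MathematicalPhysics.QuantumFieldTheory.Balaban1983to89.PBond (F.P (Summit.QuantumFields.YangMills.Theorems.K0RecordFormatNames.recordK₀ F Mc k + n)) 0) - Hr (⟨b.src.unshift ν, ν⟩ : Literature.MathematicalPhysics.QuantumFieldTheory.Balaban1983to89.PBond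 (F.P (Summit.QuantumFields.YangMills.Theorems.K0RecordFormatNames.recordK₀ F Mc k + n)) 0)))‖ ≤ C₉' * (F.P (Summit.QuantumFields.YangMills.Theorems.K0RecordFormatNames.recordK₀ F Mc k + n)).eta (k + 1) ^ 3 * Real.exp (-(δ₉ * (Literature.MathematicalPhysics.QuantumFieldTheory.Balaban1983to89.Site.tdist (Summit.QuantumFields.YangMills.Theorems.K0RecordFormatNames.coarsenTo (k + 1) b.src) y : ℝ)))) → ∃ γ₀ ε₂₉ E₀ κ α₀ α₁ : ℝ, 0 < γ₀ ∧ 0 < ε₂₉ ∧ ε₂₉ ≤ εw ∧ 0 ≤ E₀ ∧ 4 * Literature.MathematicalPhysics.QuantumFieldTheory.Balaban1983to89.B12TreeDecay.kappa₀ (4 * 2 ^ 4) (2 * 4) ≤ κ ∧ 0 < α₀ ∧ 0 < α₁ ∧ ∀ k : ℕ, ∀ v : Fin (k + 1) → ℝ, v ∈ Literature.MathematicalPhysics.QuantumFieldTheory.Balaban1983to89.FlowStep.Box γ₀ k → letI θ := Summit.QuantumFields.YangMills.Theorems.K0RecordFormatNames.thetaFill F a₀ ε₂₉; letI := θ.instVβ₁;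 letI := θ.instVβ₂; letI := θ.instιβ; Literature.MathematicalPhysics.QuantumFieldTheory.Balaban1983to89.B12FormatPlus.FormatPlusG (fun n => Summit.QuantumFields.YangMills.Theorems.K0RecordFormatNames.recordDomSys F Mc k (Summit.QuantumFields.YangMills.Theorems.K0RecordFormatNames.recordK₀ F Mc k + n)) (fun n => Summit.QuantumFields.YangMills.Theorems.K0RecordFormatNames.recordBondCount F (Summit.QuantumFields.YangMills.Theorems.K0RecordFormatNames.recordK₀ F Mc k + n)) (fun n => Summit.QuantumFields.YangMills.Theorems.K0RecordFormatNames.recordAct F (Summit.QuantumFields.YangMills.Theorems.K0RecordFormatNames.recordK₀ F Mc k + n)) (fun n => Summit.QuantumFields.YangMills.Theorems.K0RecordFormatNames.recordUc F Mc k α₀ α₁ (Summit.QuantumFields.YangMills.Theorems.K0RecordFormatNames.recordK₀ F Mc k + n)) (fun n => Summit.QuantumFields.YangMills.Theorems.K0RecordFormatNames.recordCoords F Mc k (Summit.QuantumFields.YangMills.Theorems.K0RecordFormatNames.recordK₀ F Mc k + n)) (fun n => Summit.QuantumFields.YangMills.Theorems.K0RecordFormatNames.recordChartDimJ F (Summit.QuantumFields.YangMills.Theorems.K0RecordFormatNames.recordK₀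 F Mc k + n)) (fun n => Summit.QuantumFields.YangMills.Theorems.K0RecordFormatNames.recordChartJ F Mc k (Summit.QuantumFields.YangMills.Theorems.K0RecordFormatNames.recordK₀ F Mc k + n)) (fun n => Summit.QuantumFields.YangMills.Theorems.K0RecordFormatNames.recordΦfAx F a₀ ε₂₉ k v (Summit.QuantumFields.YangMills.Theorems.K0RecordFormatNames.recordK₀ F Mc k + n)) (fun n => Summit.QuantumFields.YangMills.Theorems.K0RecordFormatNames.recordEmbJ F θ k (Summit.QuantumFields.YangMills.Theorems.K0RecordFormatNames.recordK₀ F Mc k + n)) (fun n => Summit.QuantumFields.YangMills.Theorems.K0RecordFormatNames.recordWrapCtr F Mc k (Summit.QuantumFields.YangMills.Theorems.K0RecordFormatNames.recordK₀ F Mc k + n)) (fun n => Summit.QuantumFields.YangMills.Theorems.K0RecordFormatNames.recordDomEmbCtr F Mc k (Summit.QuantumFields.YangMills.Theorems.K0RecordFormatNames.recordK₀ F Mc k + n)) (fun n _ => Summit.QuantumFields.YangMills.Theorems.K0RecordFormatNames.recordCoordProjCtr F (Summit.QuantumFields.YangMills.Theorems.K0RecordFormatNames.recordK₀ F Mc k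 + n)) E₀ κ

/-- ★ `Sig8LR4BoxBelow F εw → Sig8LR4Box F` (drop the window conjunct). [cite: Balaban1987RG1, Thm 3 p.264 (bookkeeping)] -/
theorem sig8LR4Box_of_below {F : T4Family} {εw : ℝ} (h : Sig8LR4BoxBelow F εw) : Sig8LR4Box F := by
  obtain ⟨Mth, hM⟩ := h
  refine ⟨Mth, fun Mc hMc j c c₀ c₁ B₃ B₃' a₀ a₁ hG h₁ h₂ h₃ h₄ h₅ h₆ h₇ hT8 hT9 hTE hP9 hP9L => ?_⟩
  obtain ⟨γ₀, ε₂₉, E₀, κ, α₀, α₁, hγ, hε, -, hE, hκ, hα₀, hα₁, hD⟩ := hM Mc hMc j c c₀ c₁ B₃ B₃' a₀ a₁ hG h₁ h₂ h₃ h₄ h₅ h₆ h₇ hT8 hT9 hTE hP9 hP9L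
  exact ⟨γ₀, ε₂₉, E₀, κ, α₀, α₁, hγ, hε, hE, hκ, hα₀, hα₁, hD⟩

/-- ★ K0ᴬ BY NAME from the COFINAL ⁸ (= §2′ ∘ ✓`sig8LR4Box_of_below` at `εw := 1`): the cofinal re-signing of ⁸ costs K0ᴬ nothing.  CONDITIONAL; K0ᴬ OPEN; the Yang–Mills mass gap is NOT proved.
[cite: Balaban1987RG1, Thm 1 p.259, Thm 3 p.264 (bookkeeping)] -/
theorem record13SepCoPHInhabitedAx_of_sig8LR4BoxCofinal_antecedents_orb (Tok : T4Family → ℕ → ℝ → Prop)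
    (hBr : ∀ (F : T4Family) (Mc : ℕ) (a₀ : ℝ), Tok F Mc a₀ → TokP9L4Old F Mc a₀)
    (h8c : ∀ (F : T4Family) (εw : ℝ), 0 < εw → Sig8LR4BoxBelow F εw) (hA : ∀ F, JoinAntecedentsCofinal Tok F)
    (hOrb : ∀ (F : T4Family) (Mc : ℕ) (a₀ ε₂₉ : ℝ), McGuard F Mc → 0 < a₀ → 0 < ε₂₉ →
      letI θ := thetaFill F a₀ ε₂₉; letI := θ.instVβ₁; letI := θ.instVβ₂; letI := θ.instιβ;
      (∀ (k n : ℕ) (a : θ.ιβ) (l : RespLabel F k (recordK₀ F Mc k + n)), RootedResponseOrbitAt F θ k (recordK₀ F Mc k + n) a l)) :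
    Summit.QuantumFields.YangMills.Theses.BalabanUVNodes.Record13SepCoPHInhabitedAx :=
  record13SepCoPHInhabitedAx_of_sig8LR4Box_antecedents_orb Tok hBr (fun F => sig8LR4Box_of_below (h8c F 1 one_pos)) hA hOrb

/-! ## §2  ★★ The junction THROUGH THE COFINAL ⁸ — the two letters owed ONLY IN THE SMALL-PARAMETER WINDOW (◆ CRIT-1 g38's priced repair road, typed) -/

/-- ★★ **THE JUNCTION's `hβc` THROUGH THE COFINAL ⁸ — THE HESSIAN ROW AND THE SIGN LETTER OWED ONLY IN A WINDOW `0 < ε₂₉ ≤ εw(F,a₀)`, `0 < γ₀ ≤ γw(F,a₀)`.**  ◆ CRIT-1 g38's price on §5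
(STATUS l.5379: the sign letter asked at EVERY `ε₂₉ > 0` is suspect-strong — print gives signs only for small parameters) typed as the repair it names: if ⁸ is re-signed COFINALLY in its (2.9)
parameter (`∀ εw > 0, Sig8LR4BoxBelow F εw`), then for every family and radius the consumer FIRST takes the window `(εw, γw)` in which the two letters are supplied (hypothesis `hWin`, per `(F, a₀)`),
THEN asks ⁸ below `εw` at the JOIN's cube letter, and shrinks ⁸'s level to `min γ₀ (min γw ½)` (D1 on a box is monotone in the box) — so (V-hess-cont-box) and (L-negpart-box) are consumed only
at parameters INSIDE the window.  Everything else as №16 §5 (rows by ✓`chartRowsBox_of_orbit` with antecedent (12); ✓№10 at `Mg := 4·Mc`).  NET (LENS P3): junction residue = {cofinal ⁸, `JoinAntecedentsCofinal`, (C-orb)♭}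
+ {Hessian row, sign letter} IN THE WINDOW ONLY; K0ᴬ's residue unchanged (✓`record13SepCoPHInhabitedAx_of_sig8LR4BoxCofinal_antecedents_orb`).  CONDITIONAL; every hypothesis OPEN and inhabited
NOWHERE; the junction's consumer, K0ᴬ 27238, K1ᴬ 27239 remain OPEN; NODE O 0∕1; the Yang–Mills mass gap is NOT proved.
[cite: Balaban1987RG1, Thm 2 (0.31) p.259, Thm 3 p.264, (1.18)–(1.22) pp.263–264, (5.38)–(5.44) pp.296–297; Balaban1985Variational, Prop. 9 p.309, (176)–(178) p.306] -/
theorem cofinalBetaSocketAxBody_allRadii_of_sig8LR4BoxCofinal_antecedents_orb_window (Tok : T4Family → ℕ → ℝ → Prop)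
    (hBr : ∀ (F : T4Family) (Mc : ℕ) (a₀ : ℝ), Tok F Mc a₀ → TokP9L4Old F Mc a₀)
    (h8c : ∀ (F : T4Family) (εw : ℝ), 0 < εw → Sig8LR4BoxBelow F εw) (hA : ∀ F, JoinAntecedentsCofinal Tok F)
    (hOrb : ∀ (F : T4Family) (Mc : ℕ) (a₀ ε₂₉ : ℝ), McGuard F Mc → 0 < a₀ → 0 < ε₂₉ →
      letI θ := thetaFill F a₀ ε₂₉; letI := θ.instVβ₁; letI := θ.instVβ₂; letI := θ.instιβ;
      (∀ (k n : ℕ) (a : θ.ιβ) (l : RespLabel F k (recordK₀ F Mc k + n)), RootedResponseOrbitAt F θ k (recordK₀ F Mc k + n) a l))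
    (hWin : ∀ (F : T4Family) (a₀ : ℝ), 0 < a₀ → ∃ εw γw : ℝ, 0 < εw ∧ 0 < γw ∧ ∀ (ε₂₉ γ₀ : ℝ), 0 < ε₂₉ → ε₂₉ ≤ εw → 0 < γ₀ → γ₀ ≤ γw → γ₀ ≤ 1 / 2 →
      (letI θ := thetaFill F a₀ ε₂₉; letI := θ.instVβ₁; letI := θ.instVβ₂; letI := θ.instιβ;
       (∀ k K : ℕ, ContinuousOn (fun v : Fin (k + 1) → ℝ => fderiv ℝ (fderiv ℝ (B12PolarizationTensor120.expChart (recordTermsAx F a₀ ε₂₉ k v K) θ.ρ8)) 0) (FlowStep.Box γ₀ k))) ∧ ∃ e : ℕ → ℝ, RecordPlimMomentNegPartOnBoxAx F a₀ ε₂₉ γ₀ e) :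
    ∀ F : T4Family, ∀ a : ℝ, 0 < a → CofinalBetaSocketAxBody F a := by
  intro F a ha
  obtain ⟨εw, γw, hεw, hγw, hW⟩ := hWin F a ha
  obtain ⟨Mth, h8F⟩ := h8c F εw hεw
  obtain ⟨Mc, hMc, j, c, c₀, c₁, B₃, B₃', a₁, hAnt⟩ := hA F Mth a ha
  obtain ⟨hG0, hc, hc₀, hc₁, hB₃, hB₃', ha₀, ha₁, hThm, hGauge, hUk, hBg, hP9⟩ := hAnt
  obtain ⟨γ₀, ε₂₉, E₀, κ, α₀, α₁, hγ₀, hε, hεle, hE₀, hκ, hα₀, hα₁, hD⟩ :=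
    h8F Mc hMc j c c₀ c₁ B₃ B₃' a a₁ hG0 hc hc₀ hc₁ hB₃ hB₃' ha₀ ha₁ hThm hGauge hUk hBg (hBr F Mc a hP9)
  letI θ := thetaFill F a ε₂₉; letI := θ.instVβ₁; letI := θ.instVβ₂; letI := θ.instιβ
  obtain ⟨ιC, hsw, h9⟩ := chartRowsBox_of_orbit F Mc a ε₂₉ ha (hOrb F Mc a ε₂₉ hG0 ha hε) fun k n => (hBg k n ε₂₉ hε).contDiffAt
  -- ⁸'s level shrunk into the window
  have hγ₁ : 0 < min γ₀ (min γw (1 / 2)) := lt_min hγ₀ (lt_min hγw (by norm_num))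
  have hγw : min γ₀ (min γw (1 / 2)) ≤ γw := (min_le_right _ _).trans (min_le_left _ _)
  have hγh : min γ₀ (min γw (1 / 2)) ≤ 1 / 2 := (min_le_right _ _).trans (min_le_right _ _)
  obtain ⟨hH, e, hneg⟩ := hW ε₂₉ (min γ₀ (min γw (1 / 2))) hε hεle hγ₁ hγw hγh
  refine cofinalBetaSocketAxBody_of_chartRowsBox_hessBox_negPart (Mg := 4 * (Mc : ℝ)) hE₀ hκ F a ε₂₉ (min γ₀ (min γw (1 / 2))) α₀ α₁ ha le_rfl hγ₁ hγh hε
    hα₀ hα₁ Mc hG0 le_rfl ιC (fun k v hv => hD k v ?_) hsw h9 hH hneg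
  exact mem_box.mpr fun i => ⟨(mem_box.mp hv i).1, (mem_box.mp hv i).2.trans (min_le_left _ _)⟩

-- standard axioms only
#print axioms sig8LR4Box_of_below
#print axioms record13SepCoPHInhabitedAx_of_sig8LR4BoxCofinal_antecedents_orb
#print axioms cofinalBetaSocketAxBody_allRadii_of_sig8LR4BoxCofinal_antecedents_orb_window

end Summit.QuantumFields.YangMills.Theorems.K0AxJunctionWindow
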